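import Literature.AlgebraicGeometry.ModuliOfSheaves.KummerModuliSpacesOfSheaves
import Literature.AlgebraicGeometry.Hyperkaehler.GeneralizedKummerTypeTranslationGroup
import Mathlib.RepresentationTheory.Invariants
import HarnessLib

/-!
# Yoshioka 2001, §4.1 — the étale trivialisation `M_H(v) ×_{A×Â} (A × Â) ≅ K_H(v) × A × Â` of the Albanese map and what it says about RESTRICTION to the Kummer fibre: `Im(Hᵏ(M_H(v)) → Hᵏ(K_H(v)))` is the subspace of classes invariant under a finite group of automorphisms of `K_H(v)`, and it is everything in degrees `2` and `3` (one NAMED FACT, cohomological shadow; kernel: that group lies in `Γ(K) = autFixingH2H3 K`, so every `Γ(K)`-invariant class of `K_H(v)` is a restriction from `M_H(v)`)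

Layer `Literature/AlgebraicGeometry/ModuliOfSheaves`.  Typed by a prover seat (`vhodge-19149-w3`, ladder HodgeAV
rungs №2 ∕ H3) as input "T1" of the crux idea `kummer-moduli-invariants-by-markman-on-m`
(`Summits/HodgeConjecture/HodgeConjecture/Cruxes/NonsplitSixfoldCells/Ideas/`): together with Markman 2002 Cor. 2
(`ModuliOfSheaves.Markman2002_kunnethFactors_generate_cohomology_sheafModuli`) and Bülles 2020 Thm. 0.1
(`ModuliOfSheaves.Bulles2020_sheafModuli_isDominatedByPowers_surface`) — both theorems about the MODULI SPACE
`M_H(v)`, not about its Albanese fibre — it yields the `Γ(K)`-invariant half of "`K_H(v)` is motivated by `A`"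
(summit side).  HONEST FRAMING: typed ≠ proved ≠ endorsed; ONE new named fact, the cohomological shadow of a
REFEREED construction (Math. Ann. 321 (2001)); the two clauses on degrees `2`, `3` are the refereed Thm. 0.2 (2)
and Prop. 4.20; the assembly "image of restriction = invariants of the covering group" is the standard
transfer ∕ Künneth consequence of the printed cartesian square and is flagged PRINT-SYNTHESIS below.  Nothing
here asserts the Hodge conjecture for any `K_H(v)`, `M_H(v)`, `Kumⁿ`-type variety, nor `HC ∕ HC_AV`.

## Source (read AT SOURCE this session; locators = `lit read arxiv:math/0009001`, the arXiv text, whose §5 is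
the journal's §4 and whose Thm. 1.2 ∕ Prop. 5.20 are the journal's Thm. 0.2 ∕ Prop. 4.20 — rule `5.k ↦ 4.k` as
in `KummerModuliSpacesOfSheaves`)

K. Yoshioka, *Moduli spaces of stable sheaves on abelian surfaces*, Math. Ann. 321 (2001) 817–884
[`Yoshioka2001AbelianSurfaces`; REFEREED].  §4.1 "Bogomolov decomposition" (arXiv §5.1, p0013): standing
hypotheses "`X` an abelian surface […] `v` a Mukai vector with `c₁(v) ∈ NS(X)` and `v > 0`" (L5–L12),
`𝔞_v := α × det : M̄_H(v) → X × X̂` (L13–L23); **Thm. 4.1** (arXiv Thm. 5.1, L27–L48, from [Y:3]): for `v`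
primitive, `v > 0`, `c₁(v) ∈ NS(X)`, `dim M_H(v) = ⟨v²⟩ + 2 ≥ 6` and `H` ample with `M̄_H(v) = M_H(v)`:
"(1) `θ_v` is injective. (2) `𝔞_v` is the albanese map. (3) `H²(M_H(v), ℤ) = θ_v(v^⊥) ⊕ 𝔞_v^* H²(X × X̂, ℤ)`";
**Def. 4.1** (L54–L55): "`K_H(v) := 𝔞_v⁻¹((0,0))`"; L57–L59: "We shall construct an étale covering such that `𝔞_v`
becomes trivial"; L124–L128: "`Φ : K_H(v) × X × X̂ → M_H(v)`, `Φ(E,x,y) := T_x^*(E) ⊗ 𝒫_y`"; Lemma 4.3 (arXiv 5.3,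
L130–L137): `𝔞_v(T_x^* E ⊗ 𝒫_y)` is `𝔞_v(E)` translated by a homomorphism of `(x,y)`; L170–L193: with the
isogeny `τ` and `ν =` multiplication by `n = ⟨v²⟩/2`, "`𝔞_v ∘ Φ ∘ (1_{K_H(v)} × τ)(E,x,y) = (nx, ny)`" and the
fibre product square of `𝔞_v` along `ν`; p0013:L194–p0014:L4: "`Φ ∘ (1 × τ)` and the projection […] defines a
morphism `K_H(v) × X × X̂ → M_H(v) ×_{X×X̂} X × X̂`. We can easily show that this morphism is injective, and
hence it is an isomorphism"; p0014:L5–L8 VERBATIM: "We shall consider the pull-back of `𝔞_v : M_H(v) → X × X̂` by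
the morphism sending `(x,y)` to `(nx,y)`. Then we get `M_H(v) ×_{X×X̂} X × X̂ ≅ K_H(v) × X × X̂`."
**Thm. 0.2 (2)** (arXiv Thm. 1.2 (2), p0002:L112–L136): for `v` primitive, `v > 0`, `c₁(v) ∈ NS(X)`, `⟨v²⟩ ≥ 6`:
"`θ_v : (v^⊥, ⟨ , ⟩) → (H²(K_H(v), ℤ), B_{K_H(v)})` is an isometry of Hodge structures, where `θ_v` is the
composition of Mukai homomorphism `v^⊥ → H²(M_H(v), ℤ)` and the restriction map `H²(M_H(v), ℤ) → H²(K_H(v), ℤ)`."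
**Prop. 4.20** (arXiv Prop. 5.20, p0021:L104–L122): "`j_v(x) := -(1/ρ)[p_{K_H(v)*}(ch(ℰ|_{K_H(v) × X}) x)]_{3/2}`
[…] `j_v : H¹(X, ℤ) ⊕ H³(X, ℤ) → H³(K_H(v), ℤ)_f` is an isomorphism preserving Hodge structures."
Secondary (the printed one-line form of the étale presentation): S. Floccari, Épijournal Géom. Algébrique 7
(2023) Art. 4 [`Floccari2023OG6Motive`; REFEREED] §2 (arXiv:2203.16257 p0004:L10): "`a` is isotrivial (see [Yos01]):
denoting by `K_v(A,H)` its fibre over any point, after an étale base-change `M_v(A,H)` splits as the product of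
`K_v(A,H)` with `A × Â`."

## What the printed square gives on cohomology (PRINT-SYNTHESIS: the step from the cartesian square to clause (a))

Write `M = M_H(v)`, `K = K_H(v) = 𝔞_v⁻¹(0)`, `B = X × X̂`, `ν : B → B` the isogeny of the square, `D := ker ν`
(finite).  The square says `M ≅ (K × B)/D`, where `d ∈ D` acts on `K × B` by `(E, b) ↦ (ρ(d)E, b + d)` with
`ρ(d) : K → K`, `E ↦ T^*_{x(d)} E ⊗ 𝒫_{y(d)}` for a point `(x(d), y(d)) = -τ(d)` of `B` — an automorphism of
the FINE moduli space (universal property) preserving `𝔞_v⁻¹(0)` (Lemma 4.3) — and freely (free on the factor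
`B`).  Hence (transfer for a finite group, rational coefficients; Künneth; translations of the connected group
`B` act trivially on `H*(B)`): `H*(M; ℚ) = H*(K × B; ℚ)^D = H*(K; ℚ)^{ρ(D)} ⊗ H*(B; ℚ)`, and the inclusion
`j : K = 𝔞_v⁻¹(0) ↪ M` lifts to the slice `K × {0} ⊂ K × B`, so `Im(j^* : Hᵏ(M; ℚ) → Hᵏ(K; ℚ)) = Hᵏ(K; ℚ)^{ρ(D)}`
(the `H⁰(B)`-component of the invariants).  Conversely `j ∘ ρ(d) = g_d ∘ j` with `g_d ∈ B` acting on `M` (the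
action `(x,y) · E = T_x^* E ⊗ 𝒫_y` of the connected group `B`), so `ρ(d)^* j^* = j^*` — consistent.  Clause (a)
below records exactly "`Im j^*` = the classes fixed by a finite subgroup of `Aut K`" with `ℂ`-coefficients.
Clause (b): `θ_v ⊗ ℚ = (j^* ⊗ ℚ) ∘ (Mukai hom)` is an isometry between NON-DEGENERATE lattices of the same rank
`7 = b₂(K)` (Thm. 0.2 (2); `v^⊥ ⊂ H^{ev}(X, ℤ)` with `⟨v²⟩ > 0`; Beauville's form), hence injective of finite
index, so `j^* : H²(M; ℚ) → H²(K; ℚ)` is onto (equivalently Thm. 4.1 (3)).  Clause (c): the class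
`ch(ℰ|_{K×X}) = (j × 1)^* ch(ℰ)` and `p_{K*} ∘ (j × 1)^* = j^* ∘ p_{M*}` (base change for the product projections),
so `Im j_v ⊆ Im j^*` and Prop. 4.20 makes `j^* : H³(M; ℚ) → H³(K; ℚ)` onto.

## Rendering (tree carriers) and faithfulness

* "`(M, ℰ) = M_H(v)` fine, `M̄_H(v) = M_H(v)`, smooth projective of dimension `⟨v²⟩ + 2 = 2n + 4`; `K = K_H(v)` an
  Albanese fibre, smooth projective of dimension `2n`, of `Kumⁿ`-type, `n ≥ 2`": EXACTLY the clauses of the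
  directory's `IsKummerSheafModuliSpace n A K` (`AbelianSurfaceSheafModuli C A p H v M ℰ`,
  `IsSmoothProjective (2 * n + 4) M`, an abelian variety `T`, `f : M ⟶ T`, `t ∈ T(ℂ)`, `e : K ≅ f⁻¹(t)`
  (`Motives.fiberOver`), `IsSmoothProjective (2 * n) K`, `IsOfGeneralizedKummerType n K`, `2 ≤ n`) — here
  UNBUNDLED, because the statement is about the restriction map `j^* = (e.hom ≫ fiberι f t)^*` of a given
  presentation.  As recorded in that carrier's docstring, such a `K` is an Albanese fibre `𝔞_v⁻¹(z)` of one of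
  Yoshioka's `M_H(v)` with `v` primitive of positive rank, `⟨v²⟩ = 2n + 2 ≥ 6`, `M̄ = M` (every morphism to an
  abelian variety factors through `𝔞_v`; `K` is connected of the fibre dimension; kernels of homomorphisms of
  complex abelian varieties are reduced), and all Albanese fibres are translates of `𝔞_v⁻¹(0)` under the
  `B`-action — so the printed hypotheses hold and the square applies to `j`; FEWER varieties than print (fine,
  torsion-free, `H` a polarisation class read as ample — scope sentence of `KummerModuliSpacesOfSheaves`), the
  WEAKER direction.
* (a) "`Im j^*` is the fixed space of the finite group `ρ(D) ≤ Aut K`": `∃ D : Subgroup (Aut K)`, `Finite D`, and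
  for every `k` and `c ∈ Hᵏ(K(ℂ); ℂ)`: `c ∈ range (j^*)ₖ ↔ ∀ d ∈ D, d^* c = c` (`complexBetti.map d.hom k`).
  Complex coefficients (tensor up from `ℚ`).  (b), (c): `range (j^*)₂ = ⊤`, `range (j^*)₃ = ⊤`.
* WEAKER than print: the product decomposition itself, the group `D ≅ ker ν`, the formulas for `ρ(d)`, the
  integral statements, the Beauville form and the Hodge-structure clauses are dropped; only the three
  cohomological consequences are kept.  A THEOREM in print (status: proved; the synthesis step is the standard
  transfer argument spelled out above), unproved in the tree; one named fact (D-0014).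
  -- TODO(general form): the morphism `Φ` and the `A × Â`-action on `M_H(v)` as scheme-level carriers; the
  -- integral ∕ Hodge-isometry content of Thm. 0.2 (2) and Prop. 4.20; non-fine `M_H(v)` (quasi-universal `ℰ`).

## Kernel (proved here, modulo the fact)

`D ≤ Γ(K)`: by (a) every restricted class is `D`-fixed and by (b), (c) every class of degree `2`, `3` is
restricted, so each `d ∈ D` acts as the identity on `H²(K(ℂ); ℂ)` and `H³(K(ℂ); ℂ)`, i.e. `d ∈ autFixingH2H3 K`
(`Hyperkaehler/GeneralizedKummerTypeTranslationGroup`; this is the DEFINITION of `Γ(K)`, no identification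
`Γ(K) = (ℤ/(n+1))⁴` is used).  Hence **every `Γ(K)`-invariant class of `K_H(v)` is the restriction of a class of
`M_H(v)`** (`….mem_range_of_forall_autFixingH2H3`, `….invariants_translationRep_le_range`) — step (4) of
"LEMMA D" of the crux idea, PROVED rather than assumed; and the bundled form over `IsKummerSheafModuliSpace`
(`….exists_presentation`).  The Kummer-point instance (`v = 1 - (n+1)ω`, `M = X^{[n+1]} × X̂`) of "image of
restriction = `Γ`-invariants" is the Hilbert-scheme statement `Summit.Ventures.HodgeKum4.KummerRangeEqInvariants`
∕ `Hyperkaehler.BNWS2011_autFixingH2H3_generalizedKummer` (other files; not used here).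

## What is NOT here

The reverse inclusion `Im j^* ⊆ H*(K)^{Γ(K)}` (needs `Γ(K) ⊆ ρ(D)`, i.e. the identification of `Γ(K)` with the
translation group — Floccari–Varesco ∕ BNWS, not used); Markman's and Bülles' theorems and every Hodge-conjecture
consequence (summit side: `Theorems/KummerModuliInvariantsByMarkmanOnM`); the involution `E ↦ (−1)^* E`.
-/

noncomputable section

open CategoryTheory MonoidalCategory

namespace Literature.AlgebraicGeometry.ModuliOfSheaves

open HodgeTheory
open Motives (SchemeOver AbelianVariety IsSmoothProjective ComplexPoints fiberOver fiberι)
open Hyperkaehler (autFixingH2H3 translationRep IsOfGeneralizedKummerType translationRep_apply)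

/-! ### The named fact -/

/-- **Yoshioka 2001, §4.1 étale trivialisation of the Albanese map (with Thm. 0.2 (2) and Prop. 4.20) —
REFEREED; cohomological shadow, complex coefficients: for a Kummer moduli space `K = K_H(v)` presented as an
Albanese fibre `j : K ≅ f⁻¹(t) ↪ M = M_H(v)` of a fine, smooth projective `(2n+4)`-dimensional moduli space of
stable sheaves on the abelian surface `A` (`K` smooth projective of dimension `2n`, of `Kumⁿ`-type, `n ≥ 2`):
(a) the image of the restriction map `j^* : Hᵏ(M(ℂ); ℂ) → Hᵏ(K(ℂ); ℂ)` is, in every degree `k`, the subspace of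
classes fixed by a FINITE subgroup `D ≤ Aut K` ("`M_H(v) ×_{X×X̂} X × X̂ ≅ K_H(v) × X × X̂`" along an isogeny of
`X × X̂`: `M = (K × X × X̂)/D`, transfer and Künneth — module docstring, PRINT-SYNTHESIS of that standard step);
(b) `j^*` is onto in degree `2` (Thm. 0.2 (2): `θ_v =` restriction `∘` Mukai homomorphism is an isometry
`v^⊥ ≅ H²(K_H(v), ℤ)`); (c) `j^*` is onto in degree `3` (Prop. 4.20: `j_v`, the restriction of a class built from
`ch(ℰ)` on `M`, is an isomorphism `H¹(X) ⊕ H³(X) ≅ H³(K_H(v), ℤ)_f`).**  Hypotheses = the clauses of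
`IsKummerSheafModuliSpace n A K`, unbundled (module docstring: they put `j` in Yoshioka's situation — FEWER
varieties than print).  WEAKER than print (complex coefficients; the decomposition, the group and the integral ∕
Hodge clauses dropped).  A THEOREM in print, unproved in the tree; one named fact (D-0014).
[cite: Yoshioka2001AbelianSurfaces, §4.1 (arXiv:math/0009001 §5.1 pp. 13–14: Φ, Lemma 5.3, the fibre product square, "M_H(v) ×_{X×X̂} X×X̂ ≅ K_H(v) × X × X̂"), Thm. 0.2 (2) (arXiv Thm. 1.2 (2), p. 2) and Prop. 4.20 (arXiv Prop. 5.20, p. 21)]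
[cite: Floccari2023OG6Motive, §2 (arXiv:2203.16257 p. 4: "after an étale base-change M_v(A,H) splits as the product of K_v(A,H) with A × Â")] -/
def Yoshioka2001_kummerFibre_restrictionImage : Prop :=
  ∀ (n : ℕ), 2 ≤ n → ∀ (C : ChernCharacterBetti) (A : AbelianVariety ℂ) (p : complexBetti A.X (2 * 2))
    (H : complexBetti A.X (2 * 1)) (v : (i : ℕ) → complexBetti A.X (2 * i)) (M : SchemeOver ℂ)
    (E : (A.X ⊗ M).left.Modules), AbelianSurfaceSheafModuli C A p H v M E → IsSmoothProjective (2 * n + 4) M →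
    ∀ (T : AbelianVariety ℂ) (f : M ⟶ T.X) (t : ComplexPoints T.X) ⦃K : SchemeOver ℂ⦄ (e : K ≅ fiberOver f t),
      IsSmoothProjective (2 * n) K → IsOfGeneralizedKummerType n K →
      (∃ D : Subgroup (Aut K), Finite D ∧
        ∀ (k : ℕ) (c : complexBetti K k),
          c ∈ LinearMap.range (complexBetti.map (e.hom ≫ fiberι f t) k).hom ↔
            ∀ d ∈ D, complexBetti.map d.hom k c = c) ∧
      LinearMap.range (complexBetti.map (e.hom ≫ fiberι f t) 2).hom = ⊤ ∧
      LinearMap.range (complexBetti.map (e.hom ≫ fiberι f t) 3).hom = ⊤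

namespace Yoshioka2001_kummerFibre_restrictionImage

variable {n : ℕ} {C : ChernCharacterBetti} {A : AbelianVariety ℂ} {p : complexBetti A.X (2 * 2)}
  {H : complexBetti A.X (2 * 1)} {v : (i : ℕ) → complexBetti A.X (2 * i)} {M : SchemeOver ℂ}
  {E : (A.X ⊗ M).left.Modules} {T : AbelianVariety ℂ} {f : M ⟶ T.X} {t : ComplexPoints T.X} {K : SchemeOver ℂ}

/-- Clause (b): restriction `H²(M_H(v)(ℂ); ℂ) → H²(K_H(v)(ℂ); ℂ)` is onto (Thm. 0.2 (2), shadow).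
[cite: Yoshioka2001AbelianSurfaces, Thm. 0.2 (2) (arXiv Thm. 1.2 (2))] -/
theorem range_two (h : Yoshioka2001_kummerFibre_restrictionImage) (hn : 2 ≤ n)
    (hM : AbelianSurfaceSheafModuli C A p H v M E) (hMd : IsSmoothProjective (2 * n + 4) M) (e : K ≅ fiberOver f t)
    (hK : IsSmoothProjective (2 * n) K) (hKum : IsOfGeneralizedKummerType n K) :
    LinearMap.range (complexBetti.map (e.hom ≫ fiberι f t) 2).hom = ⊤ :=
  (h n hn C A p H v M E hM hMd T f t e hK hKum).2.1

/-- Clause (c): restriction `H³(M_H(v)(ℂ); ℂ) → H³(K_H(v)(ℂ); ℂ)` is onto (Prop. 4.20, shadow).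
[cite: Yoshioka2001AbelianSurfaces, Prop. 4.20 (arXiv Prop. 5.20)] -/
theorem range_three (h : Yoshioka2001_kummerFibre_restrictionImage) (hn : 2 ≤ n)
    (hM : AbelianSurfaceSheafModuli C A p H v M E) (hMd : IsSmoothProjective (2 * n + 4) M) (e : K ≅ fiberOver f t)
    (hK : IsSmoothProjective (2 * n) K) (hKum : IsOfGeneralizedKummerType n K) :
    LinearMap.range (complexBetti.map (e.hom ≫ fiberι f t) 3).hom = ⊤ :=
  (h n hn C A p H v M E hM hMd T f t e hK hKum).2.2

/-- **KERNEL: the covering group lies in `Γ(K)`.**  The finite subgroup `D ≤ Aut K` of clause (a) fixes every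
restricted class; by (b), (c) every class of degree `2` and `3` is restricted; so each `d ∈ D` acts trivially on
`H²(K(ℂ); ℂ)` and `H³(K(ℂ); ℂ)`, i.e. `D ≤ autFixingH2H3 K` — and `Im j^*` is the fixed space of `D`.
[cite: Yoshioka2001AbelianSurfaces, §4.1 with Thm. 0.2 (2) and Prop. 4.20] -/
theorem exists_subgroup_le_autFixingH2H3 (h : Yoshioka2001_kummerFibre_restrictionImage) (hn : 2 ≤ n)
    (hM : AbelianSurfaceSheafModuli C A p H v M E) (hMd : IsSmoothProjective (2 * n + 4) M) (e : K ≅ fiberOver f t)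
    (hK : IsSmoothProjective (2 * n) K) (hKum : IsOfGeneralizedKummerType n K) :
    ∃ D : Subgroup (Aut K), Finite D ∧ D ≤ autFixingH2H3 K ∧
      ∀ (k : ℕ) (c : complexBetti K k),
        c ∈ LinearMap.range (complexBetti.map (e.hom ≫ fiberι f t) k).hom ↔
          ∀ d ∈ D, complexBetti.map d.hom k c = c := by
  obtain ⟨⟨D, hfin, hD⟩, h2, h3⟩ := h n hn C A p H v M E hM hMd T f t e hK hKum
  refine ⟨D, hfin, fun d hd ↦ ?_, hD⟩
  refine (Hyperkaehler.mem_autFixingH2H3_iff d).2 ⟨?_, ?_⟩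
  · ext c
    have hc : c ∈ LinearMap.range (complexBetti.map (e.hom ≫ fiberι f t) 2).hom := by
      rw [h2]; exact Submodule.mem_top
    exact (hD 2 c).1 hc d hd
  · ext c
    have hc : c ∈ LinearMap.range (complexBetti.map (e.hom ≫ fiberι f t) 3).hom := by
      rw [h3]; exact Submodule.mem_top
    exact (hD 3 c).1 hc d hd

/-- **KERNEL (the crux idea's input "T1" ∕ LEMMA D step (4)): every `Γ(K)`-INVARIANT class of the Kummer moduli
space `K_H(v)` is the restriction of a class of the moduli space `M_H(v)`** — degreewise form: if
`g^* c = c` for all `g ∈ autFixingH2H3 K`, then `c ∈ Im(j^* : Hᵏ(M(ℂ); ℂ) → Hᵏ(K(ℂ); ℂ))`.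
[cite: Yoshioka2001AbelianSurfaces, §4.1 with Thm. 0.2 (2) and Prop. 4.20] -/
theorem mem_range_of_forall_autFixingH2H3 (h : Yoshioka2001_kummerFibre_restrictionImage) (hn : 2 ≤ n)
    (hM : AbelianSurfaceSheafModuli C A p H v M E) (hMd : IsSmoothProjective (2 * n + 4) M) (e : K ≅ fiberOver f t)
    (hK : IsSmoothProjective (2 * n) K) (hKum : IsOfGeneralizedKummerType n K) (k : ℕ) {c : complexBetti K k}
    (hc : ∀ g : Aut K, g ∈ autFixingH2H3 K → complexBetti.map g.hom k c = c) :
    c ∈ LinearMap.range (complexBetti.map (e.hom ≫ fiberι f t) k).hom := by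
  obtain ⟨D, -, hDΓ, hD⟩ := h.exists_subgroup_le_autFixingH2H3 hn hM hMd e hK hKum
  exact (hD k c).2 fun d hd ↦ hc d (hDΓ hd)

/-- **KERNEL, representation form: `Hᵏ(K(ℂ); ℂ)^{Γ(K)} ⊆ Im j^*`** — the invariants of the representation
`translationRep K k` of `Γ(K) = autFixingH2H3 K` (`g ↦ (g⁻¹)^*`) lie in the image of restriction from `M_H(v)`.
[cite: Yoshioka2001AbelianSurfaces, §4.1 with Thm. 0.2 (2) and Prop. 4.20] -/
theorem invariants_translationRep_le_range (h : Yoshioka2001_kummerFibre_restrictionImage) (hn : 2 ≤ n)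
    (hM : AbelianSurfaceSheafModuli C A p H v M E) (hMd : IsSmoothProjective (2 * n + 4) M) (e : K ≅ fiberOver f t)
    (hK : IsSmoothProjective (2 * n) K) (hKum : IsOfGeneralizedKummerType n K) (k : ℕ) :
    (translationRep K k).invariants ≤ LinearMap.range (complexBetti.map (e.hom ≫ fiberι f t) k).hom := by
  intro c hc
  rw [Representation.mem_invariants] at hc
  refine h.mem_range_of_forall_autFixingH2H3 hn hM hMd e hK hKum k fun g hg ↦ ?_
  have h1 := hc (⟨g, hg⟩ : autFixingH2H3 K)⁻¹
  rw [translationRep_apply, inv_inv] at h1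
  exact h1

/-- **KERNEL, bundled over the carrier `IsKummerSheafModuliSpace`: every Kummer moduli space `K_H(v)` of
`Kumⁿ`-type (`n ≥ 2`) on `A` admits a fine smooth projective `(2n+4)`-dimensional moduli space `(M, ℰ) = M_H(v)` on
`A` and a morphism `j : K ⟶ M` (the inclusion of `K` as an Albanese fibre) along which every `Γ(K)`-invariant
class of every degree is a restriction, restriction being onto in degrees `2` and `3`.**  The form the summit-side
consumers (Markman-on-`M`, Bülles-on-`M`) take.
[cite: Yoshioka2001AbelianSurfaces, §4.1 with Thm. 0.1, Thm. 0.2 (2) and Prop. 4.20] -/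
theorem exists_presentation (h : Yoshioka2001_kummerFibre_restrictionImage) (hn : 2 ≤ n)
    (hKv : IsKummerSheafModuliSpace n A K) :
    ∃ (C : ChernCharacterBetti) (p : complexBetti A.X (2 * 2)) (H : complexBetti A.X (2 * 1))
      (v : (i : ℕ) → complexBetti A.X (2 * i)) (M : SchemeOver ℂ) (E : (A.X ⊗ M).left.Modules) (j : K ⟶ M),
      AbelianSurfaceSheafModuli C A p H v M E ∧ IsSmoothProjective (2 * n + 4) M ∧
        (∀ k : ℕ, (translationRep K k).invariants ≤ LinearMap.range (complexBetti.map j k).hom) ∧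
        (∀ (k : ℕ) (c : complexBetti K k), (∀ g : Aut K, g ∈ autFixingH2H3 K → complexBetti.map g.hom k c = c) →
          c ∈ LinearMap.range (complexBetti.map j k).hom) ∧
        LinearMap.range (complexBetti.map j 2).hom = ⊤ ∧ LinearMap.range (complexBetti.map j 3).hom = ⊤ := by
  obtain ⟨⟨C, p, H, v, M, E, hM, hMd, T, f, t, ⟨e⟩⟩, hK, hKum⟩ := hKv
  exact ⟨C, p, H, v, M, E, e.hom ≫ fiberι f t, hM, hMd,
    fun k ↦ h.invariants_translationRep_le_range hn hM hMd e hK hKum k,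
    fun k _ hc ↦ h.mem_range_of_forall_autFixingH2H3 hn hM hMd e hK hKum k hc,
    h.range_two hn hM hMd e hK hKum, h.range_three hn hM hMd e hK hKum⟩

end Yoshioka2001_kummerFibre_restrictionImage

end Literature.AlgebraicGeometry.ModuliOfSheaves

end
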